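/-
Copyright: lit-balaban Phase-2 proof seat p31 (gen 4).  Statement-level skeleton of a published paper; no proof claims beyond what the
kernel checks below.
-/
import Literature.MathematicalPhysics.QuantumFieldTheory.BalabanImbrieJaffe1984to88.BIJ85Eq219Proof

/-!
# `BalabanImbrieJaffe1984to88.BIJ85Eq213Adjoint` — T. Bałaban, J. Imbrie, A. Jaffe, *Renormalization of the Higgs model: minimizers,
propagators and the stability of mean field theory*, Commun. Math. Phys. **97** (1985) 299–329 [BalabanImbrieJaffe1985]: the KERNEL of
the linear bond average **(2.13)** on the tori and its ADJOINT `Q*` for the inner products **(2.14)** — *"We do not explicitly compute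
the adjoint Q*"* (p. 304): here it is computed on the surface bonds, giving **`Q^sQ* = I`**

statement-level skeleton of published theorems with citation tags; proofs where landed; nothing here is a claim about the Yang–Mills mass gap

PDF held: `paper:balaban1985-cmp97-bij-higgs-minimizers` (journal page = PDF page + 298); p. 304–305 [PDF 6–7] re-read this session
(`lit read paper:balaban1985-cmp97-bij-higgs-minimizers --pages 5-8`, text layer; the displays (2.13)–(2.19) were checked against the
image renders `run/shared/lean/pub/lit-balaban/lit-balaban-r15/pages/1985-cmp97-bij-higgs-minimizers-p006-x2.png` by gens 1–2 of this seat).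

CITATION HEADER (lean-in-tree rule).  Part of the lit-balaban TYPED SKELETON (HOME `run/shared/lean/pub/lit-balaban/`), Phase-2 seat p31
(gen 4, free-target protocol G.5-34(d), own lane = the torus block geometry of [BalabanImbrieJaffe1985] Chap. 2); rows **C1.Eq2.13** /
**C1.Eq2.14** of `HOME/SKELETON.md` (fold owner r15), and the input `Q^sQ* = I` of row **C2.Eq2.10** ([BalabanImbrieJaffe1988] (2.10),
companion file `BIJ88Eq210Torus`).

THE PRINTED TEXT (verbatim, p. 304 [PDF 6]).  *"For b′ = (b′₋, b′₊) a (directed) L-lattice bond from b′₋ to b′₊, we define the average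
(QA)_{b′} = L^{−(d+1)} Σ_{x∈B(b′₋)} Σ_{b∈Γ_{xx′}} A_b, (2.13) where Γ_{xx′} is the special contour from x to x′ and xx′ is the parallel
transport of the bond b′ to start at x. Thus the bonds b which enter the sum (2.13) range over the interior of the two L-blocks B(b′₋) and
B(b′₊), as well as the (surface) bonds connecting these blocks. The natural inner product on functions on bonds is ⟨A, B⟩_a = Σ_b a^d
A_bB_b. (2.14) We do not explicitly compute the adjoint Q*. However, we now study related averages on surface bonds which connect
adjacent blocks"*; (2.15)–(2.17) (surface bonds `B^s(b′)`, `Q^s`, `Q^{s*}`) and (2.19) *"Furthermore, by (2.13), QQ^{s*} = I"* are the rows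
of `BIJ85Sect2SurfaceAverages` (r15) / `BIJ85Eq219Proof` (this seat, gen 1).

WHAT IS REPRODUCED, and how.  On the tori of the series (`Balaban1983to89.Setup`: fine lattice `T^{(j)}` = `Site P j` / `PBond P j`,
coarse lattice `T^{(j+1)}`, block size `L = P.L`, standing range `j + 1 ≤ m + K`), with (2.13) = `LatticeFieldCalculus.bondAvg` (the reading
of record of gen 1: the contours `Γ_{xx′}` are the straight translates `[x, x + Le_μ]` of `b′ = ⟨y, y + e_μ⟩`, `runBond`):
(i) the KERNEL of (2.13), `qKer c b = L^{−(d+1)}·#{(x, t) : x ∈ B(c₋), b = the t-th bond of [x, x + Le_μ]}` (`runCount`), with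
`(QA)_c = Σ_b qKer(c,b) A_b` (`bondAvg_eq_sum_qKer`);
(ii) THE ADJOINT `Q*` for (2.14) with `a = 1` on the fine and `a = L` on the coarse lattice (the convention under which r15 proved that
(2.17) is the adjoint of (2.16), `BlockBonds.inner_Qs_eq_inner_Qsstar`): `(Q*B)_b = Σ_c L^d qKer(c,b) B_c` (`Qstar`, kernel `qstKer`),
PROVED to be the adjoint (`inner_bondAvg_eq_inner_Qstar`) and the ONLY one (`Qstar_unique`);
(iii) THE COMPUTATION the paper skips, on the surface bonds: a surface bond `b ∈ B^s(b′)` lies on exactly `L` of the contours of `b′`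
(all those on its line) and on no contour of any other coarse bond (`runCount_of_mem_Bs`), hence **`(Q*B)_b = B_{b′}` for `b ∈ B^s(b′)`**
(`Qstar_of_mem_Bs`) and, with the count `|B^s(b′)| = L^{d−1}` of gen 1 (`card_Bs`), **`Q^sQ* = I`** (`Qs_Qstar`) — the companion of
(2.19) `QQ^{s*} = I` obtained there *"by (2.13)"*; these are exactly the two identities that make (2.9) of [BalabanImbrieJaffe1988] satisfy
(2.10) (`BIJ88Sect2Statements.eq210_of`).
NOT here: the values of `Q*` on interior bonds (not needed by (2.10)); the B5 matrix carrier `B5DeltaA169.QvAdj := n^d•QvOpᴴ` of the same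
operator on `Tor (fine n M)` (no bridge attempted).  NOTHING beyond the kernel-checked statements is asserted.  Unit `lit-balaban-p31`
(literature-prover-lit-balaban-p31-g4-0), 2026-08-21.
-/

open scoped BigOperators

namespace Literature.MathematicalPhysics.QuantumFieldTheory.BalabanImbrieJaffe1984to88.BIJ85Eq213Adjoint

open Literature.MathematicalPhysics.QuantumFieldTheory.Balaban1983to89
open BIJ85Sect2SurfaceAverages LatticeFieldCalculus BIJ85Eq219Proof

variable {P : Params} {j : ℕ}

/-! ## 1. The kernel of (2.13) -/

open Classical in
/-- The multiplicity of a fine bond `b` in the double sum (2.13) for the coarse bond `c = ⟨y, y + e_μ⟩`: the number of pairs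
(`x = blockSite y r ∈ B(c₋)`, `t < L`) such that `b` is the `t`-th bond of the straight contour `Γ_{xx′} = [x, x + Le_μ]`.
[cite: BalabanImbrieJaffe1985, (2.13) p.304] -/
noncomputable def runCount (c : PBond P (j + 1)) (b : PBond P j) : ℕ :=
  ∑ r : Fin P.d → Fin P.L, ∑ t ∈ Finset.range P.L, if runBond (Site.blockSite c.src r) c.dir t = b then 1 else 0

/-- **The kernel of (2.13)** p. 304 [PDF 6]: `Q(c, b) = L^{−(d+1)}·runCount c b`, so that *"(QA)_{b′} = L^{−(d+1)} Σ_{x∈B(b′₋)} Σ_{b∈Γ_{xx′}}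
A_b (2.13)"* reads `(QA)_c = Σ_b Q(c,b) A_b` (`bondAvg_eq_sum_qKer`); rows = coarse bonds, columns = fine bonds.
[cite: BalabanImbrieJaffe1985, (2.13) p.304] -/
noncomputable def qKer (P : Params) (j : ℕ) : Matrix (PBond P (j + 1)) (PBond P j) ℝ :=
  fun c b => ((P.L : ℝ) ^ (P.d + 1))⁻¹ * (runCount c b : ℝ)

/-- kernel: `qKer` IS the kernel of (2.13) = `LatticeFieldCalculus.bondAvg` on real bond fields: `(QA)_c = Σ_b Q(c,b) A_b`.
[cite: BalabanImbrieJaffe1985, (2.13) p.304] -/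
theorem bondAvg_eq_sum_qKer (A : VecField P j ℝ) (c : PBond P (j + 1)) :
    bondAvg A c = ∑ b, qKer P j c b * A b := by
  classical
  have hrhs : ∀ b : PBond P j, qKer P j c b * A b
      = ((P.L : ℝ) ^ (P.d + 1))⁻¹ * ∑ r : Fin P.d → Fin P.L, ∑ t ∈ Finset.range P.L,
          (if runBond (Site.blockSite c.src r) c.dir t = b then A b else 0) := by
    intro b
    unfold qKer runCount
    push_cast
    rw [mul_assoc, Finset.sum_mul]
    congr 1
    refine Finset.sum_congr rfl fun r _ => ?_
    rw [Finset.sum_mul]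
    refine Finset.sum_congr rfl fun t _ => ?_
    split_ifs <;> simp
  simp_rw [hrhs]
  rw [← Finset.mul_sum, Finset.sum_comm]
  unfold bondAvg segSum
  rw [smul_eq_mul]
  congr 1
  refine Finset.sum_congr rfl fun r _ => ?_
  rw [Finset.sum_comm]
  refine Finset.sum_congr rfl fun t _ => ?_
  rw [Finset.sum_ite_eq]
  simp

/-! ## 2. The adjoint `Q*` for the inner products (2.14) -/

/-- **The adjoint `Q*` of (2.13)** for the inner products (2.14) p. 304 [PDF 6] (*"⟨A, B⟩_a = Σ_b a^d A_bB_b. (2.14) We do not explicitly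
compute the adjoint Q*"*), with `a = 1` on the fine lattice and `a = L` on the L-lattice: `(Q*B)_b = Σ_{b′} L^d Q(b′,b) B_{b′}` — a
coarse bond field pulled back to the fine bonds with the transposed kernel and the volume factor `L^d` of (2.14).
[cite: BalabanImbrieJaffe1985, (2.14) p.304] -/
noncomputable def Qstar (B : PBond P (j + 1) → ℝ) (b : PBond P j) : ℝ :=
  ∑ c, (P.L : ℝ) ^ P.d * qKer P j c b * B c

/-- The kernel of `Q*`: `Q*(b, b′) = L^d·Q(b′, b)` (rows = fine bonds, columns = coarse bonds). [cite: BalabanImbrieJaffe1985, (2.14) p.304] -/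
noncomputable def qstKer (P : Params) (j : ℕ) : Matrix (PBond P j) (PBond P (j + 1)) ℝ :=
  fun b c => (P.L : ℝ) ^ P.d * qKer P j c b

/-- kernel: `qstKer` IS the kernel of `Qstar`. [cite: BalabanImbrieJaffe1985, (2.14) p.304] -/
theorem Qstar_eq_sum_qstKer (B : PBond P (j + 1) → ℝ) (b : PBond P j) : Qstar B b = ∑ c, qstKer P j b c * B c := rfl

/-- **`Q*` IS THE ADJOINT OF (2.13) for (2.14)**: `⟨QA, B⟩_L = ⟨A, Q*B⟩_1` for all fine bond fields `A` and coarse bond fields `B`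
(`innerBond` of `BIJ85Sect2SurfaceAverages`, the convention of `BlockBonds.inner_Qs_eq_inner_Qsstar`). [cite: BalabanImbrieJaffe1985, (2.14) p.304] -/
theorem inner_bondAvg_eq_inner_Qstar (A : VecField P j ℝ) (B : PBond P (j + 1) → ℝ) :
    BlockBonds.innerBond (P.L : ℝ) P.d (bondAvg A) B = BlockBonds.innerBond 1 P.d A (Qstar B) := by
  unfold BlockBonds.innerBond Qstar
  simp only [one_pow, one_mul, bondAvg_eq_sum_qKer, Finset.mul_sum, Finset.sum_mul]
  rw [Finset.sum_comm]
  exact Finset.sum_congr rfl fun b _ => Finset.sum_congr rfl fun c _ => by ring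

/-- kernel: the adjoint for (2.14) is UNIQUE — any operator `T` with `⟨QA, B⟩_L = ⟨A, TB⟩_1` for all `A`, `B` is `Q*` (the weight
`a^d = 1` on the fine lattice is non-degenerate). [cite: BalabanImbrieJaffe1985, (2.14) p.304] -/
theorem Qstar_unique (T : (PBond P (j + 1) → ℝ) → PBond P j → ℝ)
    (hT : ∀ (A : VecField P j ℝ) (B : PBond P (j + 1) → ℝ), BlockBonds.innerBond (P.L : ℝ) P.d (bondAvg A) B = BlockBonds.innerBond 1 P.d A (T B))
    (B : PBond P (j + 1) → ℝ) (b : PBond P j) : T B b = Qstar B b := by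
  classical
  have h := hT (fun b' => if b' = b then 1 else 0) B
  rw [inner_bondAvg_eq_inner_Qstar] at h
  unfold BlockBonds.innerBond at h
  simp only [one_pow, one_mul, ite_mul, zero_mul, Finset.sum_ite_eq', Finset.mem_univ, if_true] at h
  exact h.symm

/-! ## 3. The computation on the surface bonds: `(Q*B)_b = B_{b′}` for `b ∈ B^s(b′)`, hence `Q^sQ* = I` -/

/-- `y + e_μ ≠ y` on the tori of the series (`1 ≠ 0` in `ZMod (2L^{m+K−k})`). [folklore] -/
private theorem shift_ne_self {k : ℕ} (y : Site P k) (μ : Fin P.d) : y.shift μ ≠ y := by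
  intro h
  have h1 := congrFun h μ
  simp only [Site.shift, Function.update_self] at h1
  exact one_ne_zero (add_eq_left.1 h1)

/-- kernel geometry of (2.13)/(2.15): for a surface bond `b = ⟨blockSite y s, μ⟩` of `b′ = ⟨y, y + e_μ⟩` (offset `s_μ = L − 1`,
`BIJ85Eq219Proof.Bs_eq_map`) and `t < L`, the `t`-th bond of the contour `[x, x + Le_μ]` from `x = blockSite y r ∈ B(y)` IS `b` iff `x`
lies on the line of `b` (`r` agrees with `s` off the direction `μ`) and `t = L − 1 − r_μ`. [cite: BalabanImbrieJaffe1985, (2.13) p.304] -/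
theorem runBond_eq_surface_iff (hj : j + 1 ≤ P.m + P.K) (y : Site P (j + 1)) (μ : Fin P.d) (r s : Fin P.d → Fin P.L)
    (hs : (s μ : ℕ) = P.L - 1) {t : ℕ} (ht : t < P.L) :
    runBond (Site.blockSite y r) μ t = ⟨Site.blockSite y s, μ⟩ ↔ (∀ κ, κ ≠ μ → r κ = s κ) ∧ t = P.L - 1 - r μ := by
  have hrμ := (r μ).isLt
  constructor
  · intro h
    have hsite : runSite (Site.blockSite y r) μ t = Site.blockSite y s := congrArg PBond.src h
    by_cases hlt : (r μ : ℕ) + t < P.L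
    · rw [runSite_blockSite_of_lt y r μ hlt] at hsite
      have heq := (AveragingRT.blockSite_inj hj hsite).2
      have hμ : (r μ : ℕ) + t = s μ := by
        have := congrArg Fin.val (congrFun heq μ)
        rwa [Function.update_self] at this
      refine ⟨fun κ hκ => ?_, by omega⟩
      have := congrFun heq κ
      rwa [Function.update_of_ne hκ] at this
    · exfalso
      rw [runSite_blockSite_of_ge hj y r μ (by omega) (by omega)] at hsite
      exact shift_ne_self y μ (AveragingRT.blockSite_inj hj hsite).1
  · rintro ⟨hrs, rfl⟩
    have hlt : (r μ : ℕ) + (P.L - 1 - r μ) < P.L := by omega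
    show (⟨runSite (Site.blockSite y r) μ (P.L - 1 - r μ), μ⟩ : PBond P j) = ⟨Site.blockSite y s, μ⟩
    rw [runSite_blockSite_of_lt y r μ hlt]
    congr 2
    funext κ
    by_cases hκ : κ = μ
    · subst hκ
      rw [Function.update_self]
      exact Fin.ext (by simp only; omega)
    · rw [Function.update_of_ne hκ]
      exact hrs κ hκ

open Classical in
/-- kernel: hence each contour of `b′` contains the surface bond `b` at most once, and exactly the `L` contours on the line of `b` contain
it: `Σ_{t<L} 1[t-th bond = b] = 1[x on the line of b]`. [cite: BalabanImbrieJaffe1985, (2.13) p.304] -/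
theorem sum_ite_runBond_surface (hj : j + 1 ≤ P.m + P.K) (y : Site P (j + 1)) (μ : Fin P.d) (r s : Fin P.d → Fin P.L)
    (hs : (s μ : ℕ) = P.L - 1) :
    (∑ t ∈ Finset.range P.L, if runBond (Site.blockSite y r) μ t = ⟨Site.blockSite y s, μ⟩ then 1 else 0 : ℕ)
      = if (∀ κ, κ ≠ μ → r κ = s κ) then 1 else 0 := by
  classical
  have hrμ := (r μ).isLt
  by_cases hS : ∀ κ, κ ≠ μ → r κ = s κ
  · rw [if_pos hS, Finset.sum_eq_single (P.L - 1 - r μ)]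
    · rw [if_pos ((runBond_eq_surface_iff hj y μ r s hs (by omega)).2 ⟨hS, rfl⟩)]
    · intro t ht hne
      rw [if_neg]
      intro h
      exact hne ((runBond_eq_surface_iff hj y μ r s hs (Finset.mem_range.1 ht)).1 h).2
    · intro h
      exact absurd (Finset.mem_range.2 (by omega)) h
  · rw [if_neg hS]
    refine Finset.sum_eq_zero fun t ht => ?_
    rw [if_neg]
    intro h
    exact hS ((runBond_eq_surface_iff hj y μ r s hs (Finset.mem_range.1 ht)).1 h).1

/-- kernel: the multiplicity of the surface bond `⟨blockSite y s, μ⟩` (`s_μ = L − 1`) in (2.13) for its own coarse bond `⟨y, y + e_μ⟩` is `L`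
(one contour through each of the `L` sites of `B(y)` on its line). [cite: BalabanImbrieJaffe1985, (2.13) p.304] -/
theorem runCount_surface_self (hj : j + 1 ≤ P.m + P.K) (y : Site P (j + 1)) (μ : Fin P.d) (s : Fin P.d → Fin P.L)
    (hs : (s μ : ℕ) = P.L - 1) : runCount (⟨y, μ⟩ : PBond P (j + 1)) ⟨Site.blockSite y s, μ⟩ = P.L := by
  classical
  unfold runCount
  simp_rw [sum_ite_runBond_surface hj y μ _ s hs]
  rw [Finset.sum_boole]
  have hset : (Finset.univ.filter fun r : Fin P.d → Fin P.L => ∀ κ, κ ≠ μ → r κ = s κ)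
      = Fintype.piFinset fun κ => if κ = μ then Finset.univ else {s κ} := by
    ext r
    simp only [Finset.mem_filter, Finset.mem_univ, true_and, Fintype.mem_piFinset]
    constructor
    · intro h κ
      by_cases hκ : κ = μ
      · rw [if_pos hκ]; exact Finset.mem_univ _
      · rw [if_neg hκ, Finset.mem_singleton]; exact h κ hκ
    · intro h κ hκ
      have := h κ
      rwa [if_neg hκ, Finset.mem_singleton] at this
  rw [hset, Fintype.card_piFinset, ← Finset.mul_prod_erase Finset.univ _ (Finset.mem_univ μ), if_pos rfl, Finset.card_univ,
    Fintype.card_fin, Finset.prod_congr rfl fun ν hν => by rw [if_neg (Finset.ne_of_mem_erase hν), Finset.card_singleton],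
    Finset.prod_const_one, mul_one, Nat.cast_id]

open Classical in
/-- kernel geometry of (2.13)/(2.15): a surface bond `b ∈ B^s(b′)` has multiplicity `L` in the sum (2.13) for `b′` and multiplicity `0`
for every other coarse bond (the contours of `c′` cross only the surface `B^s(c′)`, `runBond_mem_Bs`/`runBond_not_mem_Bs` of gen 1).
[cite: BalabanImbrieJaffe1985, (2.13) p.304] -/
theorem runCount_of_mem_Bs (hj : j + 1 ≤ P.m + P.K) {b : PBond P j} {c : PBond P (j + 1)}
    (h : b ∈ (torusBlockBonds P j).Bs c) (c' : PBond P (j + 1)) :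
    runCount c' b = if c' = c then P.L else 0 := by
  classical
  split_ifs with hc
  · subst hc
    obtain ⟨y, μ⟩ := c'
    rw [Bs_eq_map hj y μ, Finset.mem_map] at h
    obtain ⟨s, hsmem, rfl⟩ := h
    have hs : (s μ : ℕ) = P.L - 1 := by
      have := Fintype.mem_piFinset.mp hsmem μ
      rw [if_pos rfl, Finset.mem_singleton] at this
      exact congrArg Fin.val this
    exact runCount_surface_self hj y μ s hs
  · unfold runCount
    refine Finset.sum_eq_zero fun r _ => Finset.sum_eq_zero fun t ht => ?_
    rw [if_neg]
    intro hb
    have htL := Finset.mem_range.1 ht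
    by_cases hsurf : (r c'.dir : ℕ) + t + 1 = P.L
    · have hmem := runBond_mem_Bs hj c'.src r c'.dir hsurf
      rw [hb] at hmem
      exact hc ((torusBlockBonds P j).Bs_unique hmem h)
    · have hnot := runBond_not_mem_Bs hj c'.src r c'.dir htL hsurf c
      rw [hb] at hnot
      exact hnot h

/-- **The value of `Q*` on the surface bonds** (the computation p. 304 leaves out): `(Q*B)_b = B_{b′}` for `b ∈ B^s(b′)` —
`L^d · L^{−(d+1)} · L · B_{b′}`. [cite: BalabanImbrieJaffe1985, (2.14) p.304] -/
theorem Qstar_of_mem_Bs (hj : j + 1 ≤ P.m + P.K) (B : PBond P (j + 1) → ℝ) {b : PBond P j} {c : PBond P (j + 1)}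
    (h : b ∈ (torusBlockBonds P j).Bs c) : Qstar B b = B c := by
  classical
  have hL : (P.L : ℝ) ≠ 0 := Nat.cast_ne_zero.mpr P.L_pos.ne'
  unfold Qstar qKer
  rw [Finset.sum_eq_single c]
  · rw [runCount_of_mem_Bs hj h c, if_pos rfl, pow_succ]
    field_simp
  · intro c' _ hne
    rw [runCount_of_mem_Bs hj h c', if_neg hne]
    simp
  · intro hc
    exact absurd (Finset.mem_univ c) hc

/-- **`Q^sQ* = I`** on the tori of the series: `(Q^s(Q*B))_{b′} = L^{−(d−1)} Σ_{b∈B^s(b′)} B_{b′} = B_{b′}` (`|B^s(b′)| = L^{d−1}`,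
`BIJ85Eq219Proof.card_Bs`) — the companion of (2.19) `QQ^{s*} = I` *"by (2.13)"*, i.e. the second identity by which the localized covariance
(2.9) of [BalabanImbrieJaffe1988] *"satisfies the constraints"* (2.10). [cite: BalabanImbrieJaffe1985, (2.19) p.305] -/
theorem Qs_Qstar (hj : j + 1 ≤ P.m + P.K) (B : PBond P (j + 1) → ℝ) (c : PBond P (j + 1)) :
    (torusBlockBonds P j).Qs (Qstar B) c = B c := by
  have hL : (P.L : ℝ) ≠ 0 := Nat.cast_ne_zero.mpr P.L_pos.ne'
  unfold BlockBonds.Qs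
  rw [Finset.sum_congr rfl fun b hb => Qstar_of_mem_Bs hj B hb, Finset.sum_const, card_Bs hj, nsmul_eq_mul]
  show ((P.L : ℝ) ^ (P.d - 1))⁻¹ * ((P.L ^ (P.d - 1) : ℕ) * B c) = B c
  push_cast
  rw [← mul_assoc, inv_mul_cancel₀ (pow_ne_zero _ hL), one_mul]

open Classical in
/-- kernel, matrix form: `Q*` applied to a coarse field is the kernel sum `Σ_{b′} Q*(b,b′)B_{b′}`, and on a surface bond `b ∈ B^s(b′)`
the row `Q*(b, ·)` is the indicator of `b′`. [cite: BalabanImbrieJaffe1985, (2.14) p.304] -/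
theorem qstKer_of_mem_Bs (hj : j + 1 ≤ P.m + P.K) {b : PBond P j} {c : PBond P (j + 1)} (h : b ∈ (torusBlockBonds P j).Bs c)
    (c' : PBond P (j + 1)) : qstKer P j b c' = if c' = c then 1 else 0 := by
  classical
  have hL : (P.L : ℝ) ≠ 0 := Nat.cast_ne_zero.mpr P.L_pos.ne'
  unfold qstKer qKer
  rw [runCount_of_mem_Bs hj h c']
  split_ifs
  · rw [pow_succ]
    field_simp
  · simp

end Literature.MathematicalPhysics.QuantumFieldTheory.BalabanImbrieJaffe1984to88.BIJ85Eq213Adjoint
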